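import Literature.MathematicalPhysics.QuantumFieldTheory.Balaban1983to89.B12QPrime348
import Literature.MathematicalPhysics.QuantumFieldTheory.Balaban1983to89.B7Prop5Flat

/-!
# `Balaban1983to89.B12Ineq349PerBond` — [Balaban1987RG1] (3.49) p. 279 from PER-BOND bounds on `δQ/δA`
([Balaban1985Averaging] (138) p. 39, Prop. 5 (156) p. 42): the junction «functional derivative = partial derivatives
× η^{−d}» ⟹ sup → sup operator bound, PROVED

HONEST FRAMING (cell `lit-balaban`, verbatim): statement-level skeleton of published theorems with citation tags; proofs
where landed; nothing here is a claim about the Yang–Mills mass gap.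

CITATION HEADER.  T. Bałaban, *Renormalization group approach to lattice gauge field theories. I. Generation of
effective actions in a small field approximation and a coupling constant renormalization in four dimensions*,
Commun. Math. Phys. **109** (1987) 249–301, doi:10.1007/bf01215223 [Balaban1987RG1] (cell paper B12 = [I]; journal page
= PDF page + 248; displays read as images from the page renders `b2b-balaban-ref1/pages/1987-cmp109-rg-I-small-field/
…-p031-x2.png` (p. 279) and `…-p037-x2.png` (p. 285)); T. Bałaban, *Averaging operations for lattice gauge theories*,
Commun. Math. Phys. **98** (1985) 17–51 [Balaban1985Averaging] (cell paper B7 = [7] of [I]; (138) p. 39, (141) p. 39,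
(147)/(150) p. 40, Prop. 5 (156) p. 42, quoted from the verbatim transcript in the header of the tree file `B7Prop5Flat`).
Unit `lit-balaban-r20` (fold owner of B12), rows `B12.Eq3.48-3.49` (supplement) and `B12.Eq4.16-4.18` (service: the
same input feeds (4.17), p07's `B12Eq416DerivB.norm_dB_le`).

WHAT IS PRINTED (verbatim).  [I] p. 279 [PDF 31], after (3.48): *«The function Q′ satisfies the inequality
|Q′| ≤ O(1)L^jη|𝐀| < O(1)α₂L^jη on □₀, (3.49) with an absolute constant O(1).»*  [I] p. 285 [PDF 37], before (4.17):
*«The field A is regular on η-lattice, it satisfies the bounds (3.32), hence the derivative ∂^ξA_λ can be bounded by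
O(1)L^jη. The same remark applies to the derivative ∂^ξζ̃_□. More precisely, (3.32) and Proposition 5 [7] on functional
derivatives of averaging operations imply |(∂_νB_μ)(x)| < O(1)(α₂ + B₃O(1)Mα₀)(L^jη)² < α₁(L^jη)². (4.17)»*
[7] p. 39, (138): *«(d/dt)F(A + tδA)|_{t=0} = Σ_{b⊂Ω} η^d tr (δF(A)/δA_b) δA_b = ⟨δF(A)/δA, δA⟩. (138) From this
definition it follows easily that the functional derivative coincides with partial derivatives (gradient) of F(A)
multiplied by η^{−d}.»*  [7] p. 39, (141): *«(Q″_kA)_c = Σ_{b⊂B^k(c₋)∪B^k(c₊)} η^dA_b»*; p. 40, (150): *«Q_j(U₀, ηA) =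
L^jηQ_j(U₀)A + C_j(U₀, L^jηA)»*; p. 42, Proposition 5, (156): *«|(δ/δA_b)Q_k(U₀, ηA, c)| ≤ 1 + 2C′₁α₀ + C₃|A| <
1 + 2C′₁α₀ + C₃α₁»*, the derivative being local: zero unless `b ⊂ B^k(c₋) ∪ B^k(c₊)` (Prop. 4 p. 38, (141)).

WHY THIS FILE.  The tree's (3.49) (`B12QPrime348.ineq349_printed` / `ineq349_lam330`, r20 p243393) consumes the input
«‖δQ/δA‖ ≤ O(1)L^j» as an OPERATOR-norm hypothesis `‖fderiv ℝ Q y‖ ≤ C·L^j` on the Fréchet derivative of the averaging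
map `Q` between sup-normed bond-function spaces, because [I] p. 279 gives no source for it.  [I] names the source one
section later (p. 285: «Proposition 5 [7]»), and Proposition 5 of [7] is a PER-BOND statement in the normalisation
(138): a bound on each `δQ(c)/δA_b` together with the locality «`b ⊂ B^k(c₋) ∪ B^k(c₊)`».  The passage from per-bond
bounds to the operator bound is the remark after (138) («partial derivatives multiplied by η^{−d}») made quantitative:
for a continuous linear map `f` out of a FINITE product with the sup norm, `f(δA) = Σ_b f(δA_b·δ_b)`, hence
`‖f‖_{sup→sup} ≤ max_c Σ_b M_{c,b}` whenever `‖f(X·δ_b)(c)‖ ≤ M_{c,b}‖X‖` — the ROW SUMS of the matrix of partial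
derivatives.  With (156) and (141), `M_{c,b} = η^d·(1 + 2C′₁α₀ + C₃α₁)·𝟙[b ⊂ B^j(c₋) ∪ B^j(c₊)]` for the composite
`A ↦ Q_j(U₀, ηA)`, and the printed `L^j` of (3.49) is the scale of (150) («Q_j(U₀, ηA) = L^jηQ_j(U₀)A + …», the
derivative in (3.48) being taken with respect to the UNscaled argument of `Q`).

WHAT THIS FILE PROVES (kernel, no `sorry`, standard axioms; no `def`, no `def … : Prop`).
* §1 (pure Mathlib, any nontrivially normed field `𝕜`, any finite index type, sup-normed products `Π_b E_b`):
  `map_eq_sum_single` (`f x = Σ_b f(x_b·δ_b)`), `opNorm_le_of_single_le` (`‖f‖ ≤ Σ_b M_b` from `‖f(X·δ_b)‖ ≤ M_b‖X‖`),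
  `opNorm_le_sum_norm_comp_single` (`‖f‖ ≤ Σ_b ‖f ∘ single_b‖`), and, for maps INTO a finite sup-normed product,
  **`opNorm_le_of_rowSum_le`**: `‖f(X·δ_b)(c)‖ ≤ M_{c,b}‖X‖`, `Σ_b M_{c,b} ≤ K` (all `c`) ⟹ `‖f‖ ≤ K`.
* §2 the same for a Fréchet derivative `fderiv ℝ Q y` between bond-function spaces (`norm_fderiv_le_of_perBond`), and
  the locality bookkeeping `rowSum_le_of_local`: `M_{c,b} ≤ m` on a support set `supp c` of at most `N` bonds and `= 0`
  off it ⟹ `Σ_b M_{c,b} ≤ N·m` (B7's `B7Prop5Flat.sum_le_card_mul_of_zero`, BY NAME).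
* §3 **`ineq349_lam330_perBond`**: (3.49) for the concrete `Λ` of (3.30)/(3.48) (`B12QPrime348.lam330`, `qPrime`, BY
  NAME) with the operator hypothesis of `ineq349_lam330` REPLACED by per-bond bounds with row sums `≤ C·L^j`; and
  **`ineq349_lam330_local`**: the same from a uniform per-bond bound `m`, locality sets of `≤ N` bonds, `N·m ≤ C·L^j`.

WHAT IS NOT PROVED HERE (recorded, not asserted).  The B7-side INSTANCE — that the concrete composite averaging of [7]
(`B7Prop5Flat.logIter`, flat background; `B7Prop4GeneralLevels.logCovIter`, general background), restricted to the
finitely many bond variables it depends on, is Fréchet differentiable with per-bond bounds (156) and the row count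
`#{b ⊂ B^j(c₋) ∪ B^j(c₊)}·η^d·(…) ≤ O(1)L^j` in [I]'s conventions — is NOT done here: the tree's Proposition 5
(`B7Prop5Flat.prop5_flat_156`, `B7Prop5GeneralInduction.prop5_156`) is stated with LINE derivatives in single-bond
directions on the infinite lattice `ℤ^d → 𝔸`, not with a Fréchet derivative on a finite product, and the identification
of [I]'s `L^j` with (150)'s scale is a reading of the print, recorded above, not a theorem of this file.  The hypotheses
`hDQ`/`hrow` (resp. `hDQ`/`hloc`/`hN`) of §3 are exactly that remaining input.
-/

namespace Literature.MathematicalPhysics.QuantumFieldTheory.Balaban1983to89.B12Ineq349PerBond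

open Set
open Literature.MathematicalPhysics.QuantumFieldTheory.Balaban1983to89
open Literature.MathematicalPhysics.QuantumFieldTheory.Balaban1983to89.B12QPrime348 (qPrime lam330 small330
  ineq349_lam330)

/-! ## §1  Operator norm out of a finite sup-normed product: the row sums of the matrix of partial maps -/

section OpNorm

variable {𝕜 : Type*} [NontriviallyNormedField 𝕜] {ι : Type*} [Fintype ι] [DecidableEq ι]
  {E : ι → Type*} [∀ i, NormedAddCommGroup (E i)] [∀ i, NormedSpace 𝕜 (E i)]
  {F : Type*} [NormedAddCommGroup F] [NormedSpace 𝕜 F]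

/-- «`⟨δF/δA, δA⟩ = Σ_{b⊂Ω} η^d tr (δF/δA_b) δA_b`» (138) for a LINEAR `f` on a finite product: `f(x) = Σ_b f(x_b·δ_b)`
(`x = Σ_b x_b·δ_b`, Mathlib `Finset.univ_sum_single`). [cite: Balaban1985Averaging, (138) p.39] (elementary API for the
per-bond ⟹ operator junction; our proof) -/
theorem map_eq_sum_single (f : (Π i, E i) →L[𝕜] F) (x : Π i, E i) : f x = ∑ i, f (Pi.single i (x i)) := by
  conv_lhs => rw [← Finset.univ_sum_single x]
  rw [map_sum]

/-- **Per-coordinate bounds ⟹ operator bound**: if `‖f(X·δ_b)‖ ≤ M_b‖X‖` for every coordinate `b` and every `X`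
(`M_b ≥ 0`), then `‖f‖ ≤ Σ_b M_b` for the sup norm on the finite product («the functional derivative coincides with
partial derivatives … multiplied by η^{−d}», (138), summed over the bonds). [cite: Balaban1985Averaging, (138) p.39]
(elementary API; our proof) -/
theorem opNorm_le_of_single_le (f : (Π i, E i) →L[𝕜] F) {M : ι → ℝ} (hM0 : ∀ i, 0 ≤ M i)
    (hM : ∀ i (x : E i), ‖f (Pi.single i x)‖ ≤ M i * ‖x‖) : ‖f‖ ≤ ∑ i, M i := by
  refine ContinuousLinearMap.opNorm_le_bound f (Finset.sum_nonneg fun i _ => hM0 i) fun x => ?_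
  rw [map_eq_sum_single f x, Finset.sum_mul]
  refine (norm_sum_le _ _).trans (Finset.sum_le_sum fun i _ => ?_)
  exact (hM i (x i)).trans (mul_le_mul_of_nonneg_left (norm_le_pi_norm x i) (hM0 i))

/-- `‖f‖ ≤ Σ_b ‖f ∘ single_b‖` for a continuous linear map out of a finite sup-normed product.
[cite: Balaban1985Averaging, (138) p.39] (elementary API; our proof) -/
theorem opNorm_le_sum_norm_comp_single (f : (Π i, E i) →L[𝕜] F) :
    ‖f‖ ≤ ∑ i, ‖f.comp (ContinuousLinearMap.single 𝕜 E i)‖ :=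
  opNorm_le_of_single_le f (fun _ => norm_nonneg _) fun i x =>
    (f.comp (ContinuousLinearMap.single 𝕜 E i)).le_opNorm x

variable {ι' : Type*} [Fintype ι'] {G : ι' → Type*} [∀ c, NormedAddCommGroup (G c)] [∀ c, NormedSpace 𝕜 (G c)]

/-- **Row sums ⟹ sup → sup operator bound**: for a continuous linear map `f` from the finite sup-normed product
`Π_b E_b` (fine bond functions) to the finite sup-normed product `Π_c G_c` (coarse bond functions), if
`‖f(X·δ_b)(c)‖ ≤ M_{c,b}‖X‖` (`M_{c,b} ≥ 0`) and every ROW SUM satisfies `Σ_b M_{c,b} ≤ K` (`K ≥ 0`), then `‖f‖ ≤ K` —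
the mechanism turning the per-bond bound (156) with the locality (141) into the «O(1)» operator constants of [I].
[cite: Balaban1985Averaging, (138) p.39, (141) p.39, (156) p.42] (elementary API; our proof) -/
theorem opNorm_le_of_rowSum_le (f : (Π i, E i) →L[𝕜] (Π c, G c)) {M : ι' → ι → ℝ} (hM0 : ∀ c i, 0 ≤ M c i)
    (hM : ∀ i (x : E i) (c : ι'), ‖f (Pi.single i x) c‖ ≤ M c i * ‖x‖) {K : ℝ} (hK0 : 0 ≤ K)
    (hK : ∀ c, ∑ i, M c i ≤ K) : ‖f‖ ≤ K := by
  refine ContinuousLinearMap.opNorm_le_bound f hK0 fun x => ?_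
  refine (pi_norm_le_iff_of_nonneg (by positivity)).mpr fun c => ?_
  rw [map_eq_sum_single f x, Finset.sum_apply]
  calc ‖∑ i, f (Pi.single i (x i)) c‖ ≤ ∑ i, ‖f (Pi.single i (x i)) c‖ := norm_sum_le _ _
    _ ≤ ∑ i, M c i * ‖x‖ := Finset.sum_le_sum fun i _ =>
        (hM i (x i) c).trans (mul_le_mul_of_nonneg_left (norm_le_pi_norm x i) (hM0 c i))
    _ = (∑ i, M c i) * ‖x‖ := (Finset.sum_mul _ _ _).symm
    _ ≤ K * ‖x‖ := mul_le_mul_of_nonneg_right (hK c) (norm_nonneg _)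

end OpNorm

/-! ## §2  The same for a Fréchet derivative between bond-function spaces, and the locality bookkeeping -/

section PerBond

variable {ι ι' : Type*} [Fintype ι] [DecidableEq ι] [Fintype ι']
  {V : Type*} [NormedAddCommGroup V] [NormedSpace ℝ V] {W : Type*} [NormedAddCommGroup W] [NormedSpace ℝ W]

/-- **`‖δQ/δA‖_{sup→sup} ≤ max_c Σ_b M_{c,b}`** for the Fréchet derivative of a map `Q` from fine bond functions
`ι → V` to coarse bond functions `ι' → W` at a point `y`, given the per-bond bounds `‖(DQ)_y(X·δ_b)(c)‖ ≤ M_{c,b}‖X‖`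
(in the normalisation (138): `M_{c,b} = η^d·|δQ(c)/δA_b|`) and the row sums `Σ_b M_{c,b} ≤ K`.
[cite: Balaban1985Averaging, (138) p.39, (156) p.42] (elementary API; our proof) -/
theorem norm_fderiv_le_of_perBond {Q : (ι → V) → (ι' → W)} {y : ι → V} {M : ι' → ι → ℝ}
    (hM0 : ∀ c b, 0 ≤ M c b) (hM : ∀ b (X : V) c, ‖fderiv ℝ Q y (Pi.single b X) c‖ ≤ M c b * ‖X‖) {K : ℝ}
    (hK0 : 0 ≤ K) (hK : ∀ c, ∑ b, M c b ≤ K) : ‖fderiv ℝ Q y‖ ≤ K :=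
  opNorm_le_of_rowSum_le (fderiv ℝ Q y) hM0 hM hK0 hK

omit [DecidableEq ι] [Fintype ι'] in
/-- **Locality bookkeeping** ((141): the derivative `δQ(c)/δA_b` vanishes unless `b ⊂ B^j(c₋) ∪ B^j(c₊)`): if
`M_{c,b} ≤ m` on a support set `supp c` of at most `N` bonds (`m ≥ 0`) and `M_{c,b} = 0` off it, then every row sum is
`≤ N·m` (B7's counting lemma `B7Prop5Flat.sum_le_card_mul_of_zero`, BY NAME). [cite: Balaban1985Averaging, (141) p.39, (156) p.42]
(elementary API; our proof) -/
theorem rowSum_le_of_local (supp : ι' → Finset ι) {M : ι' → ι → ℝ} {m : ℝ} (hm : 0 ≤ m)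
    (hle : ∀ c b, M c b ≤ m) (hzero : ∀ c b, b ∉ supp c → M c b = 0) {N : ℕ} (hN : ∀ c, (supp c).card ≤ N)
    (c : ι') : ∑ b, M c b ≤ N * m :=
  calc ∑ b, M c b ≤ (supp c).card * m :=
        B7Prop5Flat.sum_le_card_mul_of_zero Finset.univ (supp c) (M c) hm (fun b _ => hle c b)
          (fun b _ hb => hzero c b hb)
    _ ≤ N * m := mul_le_mul_of_nonneg_right (by exact_mod_cast hN c) hm

end PerBond

/-! ## §3  (3.49) for the concrete `Λ` from per-bond bounds on `δQ/δA` -/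

section Junction

variable {ι ι' : Type*} [Fintype ι] [DecidableEq ι] [Fintype ι']
  {𝔸 : Type*} [NormedRing 𝔸] [NormedAlgebra ℂ 𝔸] [CompleteSpace 𝔸]

/-- **(3.49) from PER-BOND bounds** («Proposition 5 [7] on functional derivatives of averaging operations», [I] p. 285):
for the concrete `Λ(·, h) = lam330 η h` of (3.30)/(3.48) (`η > 0`, `𝐀 ∈ small330 η h`), an averaging map `Q` from the
bond functions on the finite fine bond set `ι` to those on the finite coarse bond set `ι'`, per-bond bounds
`‖(DQ)_y(X·δ_b)(c)‖ ≤ M_{c,b}‖X‖` on the set `u ⊇ ηΛ(small330 η h)` (the shape of (156) in the normalisation (138),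
`M_{c,b} = η^d·(1 + 2C′₁α₀ + C₃α₁)·𝟙[b ⊂ B^j(c₋)∪B^j(c₊)]`) and row sums `Σ_b M_{c,b} ≤ C·L^j` (the scale `L^j` of
(150) [7]), one has `|Q′| ≤ (11C/8)L^jη|𝐀|`, and `< (11C/8)α₂L^jη` when `|𝐀| < α₂`, `(11C/8)L^jη > 0` — the printed
«|Q′| ≤ O(1)L^jη|𝐀| < O(1)α₂L^jη» (`B12QPrime348.ineq349_lam330` BY NAME, its operator hypothesis discharged by §1–§2).
[cite: Balaban1987RG1, (3.49) p.279, p.285 (before (4.17))] -/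
theorem ineq349_lam330_perBond {u : Set (ι → 𝔸)} {Q : (ι → 𝔸) → (ι' → 𝔸)} {η : ℝ} (hη : 0 < η) {h A : ι → 𝔸}
    (hA : A ∈ small330 η h) (hmaps : ∀ x ∈ small330 η h, η • lam330 η h x ∈ u) {C L α₂ : ℝ} {j : ℕ}
    {M : ι' → ι → ℝ} (hM0 : ∀ c b, 0 ≤ M c b)
    (hDQ : ∀ y ∈ u, ∀ b (X : 𝔸) c, ‖fderiv ℝ Q y (Pi.single b X) c‖ ≤ M c b * ‖X‖)
    (hrow : ∀ c, ∑ b, M c b ≤ C * L ^ j) (hCL : 0 ≤ C * L ^ j) :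
    ‖qPrime Q (lam330 η h) η A‖ ≤ (C * (11 / 8)) * L ^ j * η * ‖A‖ ∧
      (‖A‖ < α₂ → 0 < C * (11 / 8) * L ^ j * η →
        ‖qPrime Q (lam330 η h) η A‖ < (C * (11 / 8)) * α₂ * L ^ j * η) :=
  ineq349_lam330 hη hA hmaps fun y hy => norm_fderiv_le_of_perBond hM0 (hDQ y hy) hCL hrow

/-- **(3.49) from a UNIFORM per-bond bound and LOCALITY**: if on `u` every partial derivative satisfies
`‖(DQ)_y(X·δ_b)(c)‖ ≤ m‖X‖` for the bonds `b` of a set `supp c` of at most `N` fine bonds («`b ⊂ B^j(c₋) ∪ B^j(c₊)`»,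
(141) [7]) and vanishes for the other bonds, and `N·m ≤ C·L^j`, then the conclusion of (3.49) holds as in
`ineq349_lam330_perBond`. [cite: Balaban1987RG1, (3.49) p.279, p.285 (before (4.17))] -/
theorem ineq349_lam330_local {u : Set (ι → 𝔸)} {Q : (ι → 𝔸) → (ι' → 𝔸)} {η : ℝ} (hη : 0 < η) {h A : ι → 𝔸}
    (hA : A ∈ small330 η h) (hmaps : ∀ x ∈ small330 η h, η • lam330 η h x ∈ u) {C L α₂ m : ℝ} {j N : ℕ}
    (supp : ι' → Finset ι) (hm : 0 ≤ m) (hN : ∀ c, (supp c).card ≤ N)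
    (hDQ : ∀ y ∈ u, ∀ c, ∀ b ∈ supp c, ∀ X : 𝔸, ‖fderiv ℝ Q y (Pi.single b X) c‖ ≤ m * ‖X‖)
    (hloc : ∀ y ∈ u, ∀ c, ∀ b ∉ supp c, ∀ X : 𝔸, fderiv ℝ Q y (Pi.single b X) c = 0)
    (hNm : (N : ℝ) * m ≤ C * L ^ j) :
    ‖qPrime Q (lam330 η h) η A‖ ≤ (C * (11 / 8)) * L ^ j * η * ‖A‖ ∧
      (‖A‖ < α₂ → 0 < C * (11 / 8) * L ^ j * η →
        ‖qPrime Q (lam330 η h) η A‖ < (C * (11 / 8)) * α₂ * L ^ j * η) := by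
  classical
  -- the matrix of per-bond bounds: `m` on the support, `0` off it
  let M : ι' → ι → ℝ := fun c b => if b ∈ supp c then m else 0
  have hM0 : ∀ c b, 0 ≤ M c b := fun c b => by
    dsimp only [M]; split_ifs <;> [exact hm; exact le_rfl]
  have hMle : ∀ c b, M c b ≤ m := fun c b => by
    dsimp only [M]; split_ifs <;> [exact le_rfl; exact hm]
  have hMzero : ∀ c b, b ∉ supp c → M c b = 0 := fun c b hb => by
    dsimp only [M]; rw [if_neg hb]
  have hDQ' : ∀ y ∈ u, ∀ b (X : 𝔸) c, ‖fderiv ℝ Q y (Pi.single b X) c‖ ≤ M c b * ‖X‖ := by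
    intro y hy b X c
    dsimp only [M]
    split_ifs with hb
    · exact hDQ y hy c b hb X
    · rw [hloc y hy c b hb X, norm_zero, zero_mul]
  have hrow : ∀ c, ∑ b, M c b ≤ C * L ^ j := fun c =>
    (rowSum_le_of_local supp hm hMle hMzero hN c).trans hNm
  have hCL : 0 ≤ C * L ^ j := le_trans (by positivity) hNm
  exact ineq349_lam330_perBond hη hA hmaps hM0 hDQ' hrow hCL

end Junction

end Literature.MathematicalPhysics.QuantumFieldTheory.Balaban1983to89.B12Ineq349PerBond
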